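import Summits.CriticalPhenomena.PercolationContinuityZ3.Theorems.PercNearOneGluingNoHeavyLowerTailMajorityGluingSix
import Summits.CriticalPhenomena.PercolationContinuityZ3.Theorems.PercNearOneGluingNoHeavyLowerTailMajorityGluingSevenAbstract
import HarnessLib

/-!
# Majority gluing at `|A| = 7` with loss `(33259/16384)·max` from van den Berg–Kahn log-supermodularity
# (lane prim-rate; row M1-V7 — percolation assembly on the abstract bound `HubOnly.fourOfFive_sym`)

Support file for the closed crux `NoHeavyLowerTail` (stmt-CriticalPhenomena-4575; `--supports … --as helper`).  The `|A| = 7` rung of the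
explicit-constant ladder for MAJORITY GLUING (row M1-L2 of `run/shared/lean/prim/prim-rate/BENCH.md`): the kernel has
`C(|A|) = 1 + (|A| − 2)/⌈|A|/2⌉` (`majorityGluing_of_additiveGluing`; `9/4` at `|A| = 7`), `C(6) ≤ 499/243` (`majorityGluing_vdBK_card_six`,
`PercNearOneGluingNoHeavyLowerTailMajorityGluingSix.lean`), and the universal constant exactly `3` (`…MajorityGluingSharpThree.lean`).
Here: **`C(7) ≤ 1 + 16875/16384 = 33259/16384 ≈ 2.0300`** (`majorityGluing_vdBK_card_seven`), by the route of the `|A| = 6` file with five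
relays: peel an auxiliary relay `c ≠ a₀`; on `{c ↔ a₀}` the hub-only event forces at least four of the five relays `T = A ∖ {a₀, c}` to be cut
from `a₀`; the probability of «at least four of five cut» is the union of the five quadruple-avoidance events, bounded through
van den Berg–Kahn log-supermodularity of avoidance probabilities (`BergKahn.bergKahn_avoidance`, [VandenbergKahn2001, Thm 1.2]) by the
abstract optimum `16875/16384 · max_i μ(bᵢ ↮ a₀)` (`HubOnly.fourOfFive_sym`: ten instances (A) on pairs of quadruples, five instances (B) on
index-disjoint pairs of triples); `HubOnly.majorityGluing_of_hubOnly` turns the hub-only bound into majority gluing.  The abstract constant is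
mine-ref-g11's (hand proof `ref/g11/V7-ABSTRACT-PROOF-g11.md`, verified by audit-3-g10); the row is constants-miner 1's (M1-V7); this file was
written by audit seat 3 (gen 10) as the row's kernel certificate, generated from the `|A| = 6` file's pattern.
No definitions, no named facts, no sorries. [cite: VandenbergKahn2001, Thm 1.2 (p. 123)] [cite: KozmaNitzan2024, Conj. 1 (p. 3)]
-/

noncomputable section

namespace Summit.CriticalPhenomena.PercolationContinuityZ3.Theorems

open MeasureTheory Set
open Literature.Probability.LatticeModels
open Literature.Probability.Percolation
open scoped Classical

namespace HubOnly

variable {n : ℕ}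

/-! ### The percolation four-of-five bound from log-supermodularity -/

/-- The abstract four-of-five inequality on the avoidance probabilities of five relays: with `u_i = P(a₀ ↛ T ∖ {bᵢ})`, `q = P(a₀ ↛ T)`,
`Σ u_i − 4q ≤ (16875/16384)·max_i P(bᵢ ↮ a₀)` — the hypotheses of `fourOfFive_sym` are instances of van den Berg–Kahn log-supermodularity
(`BergKahn.bergKahn_avoidance`) and of monotonicity of avoidance. [cite: VandenbergKahn2001, Thm 1.2 (p. 123)] -/
theorem fourOfFive_sum_le (w : Sym2 (Fin n) → unitInterval) (a₀ b₁ b₂ b₃ b₄ b₅ : Fin n) (δ : ℝ)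
    (h₁ : (prodBernoulli w).real (openConn a₀ b₁ : Set (BondConfig (Fin n)))ᶜ ≤ δ)
    (h₂ : (prodBernoulli w).real (openConn a₀ b₂ : Set (BondConfig (Fin n)))ᶜ ≤ δ)
    (h₃ : (prodBernoulli w).real (openConn a₀ b₃ : Set (BondConfig (Fin n)))ᶜ ≤ δ)
    (h₄ : (prodBernoulli w).real (openConn a₀ b₄ : Set (BondConfig (Fin n)))ᶜ ≤ δ)
    (h₅ : (prodBernoulli w).real (openConn a₀ b₅ : Set (BondConfig (Fin n)))ᶜ ≤ δ) :
    (prodBernoulli w).real {ω : BondConfig (Fin n) | ∀ x ∈ ({b₂, b₃, b₄, b₅} : Set (Fin n)), ω ∉ openConn a₀ x} + (prodBernoulli w).real {ω : BondConfig (Fin n) | ∀ x ∈ ({b₁, b₃, b₄, b₅} : Set (Fin n)), ω ∉ openConn a₀ x} + (prodBernoulli w).real {ω : BondConfig (Fin n) | ∀ x ∈ ({b₁, b₂, b₄, b₅} : Set (Fin n)), ω ∉ openConn a₀ x} + (prodBernoulli w).real {ω : BondConfig (Fin n) | ∀ x ∈ ({b₁, b₂, b₃, b₅} : Set (Fin n)),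 ω ∉ openConn a₀ x} + (prodBernoulli w).real {ω : BondConfig (Fin n) | ∀ x ∈ ({b₁, b₂, b₃, b₄} : Set (Fin n)), ω ∉ openConn a₀ x} -
        4 * (prodBernoulli w).real {ω : BondConfig (Fin n) | ∀ x ∈ ({b₁, b₂, b₃, b₄, b₅} : Set (Fin n)), ω ∉ openConn a₀ x} ≤ 16875 / 16384 * δ := by
  have hd : ∀ b : Fin n, (prodBernoulli w).real (openConn a₀ b : Set (BondConfig (Fin n)))ᶜ ≤ δ →
      (prodBernoulli w).real {ω : BondConfig (Fin n) | ∀ x ∈ ({b} : Set (Fin n)), ω ∉ openConn a₀ x} ≤ δ := by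
    intro b hb; rw [avoid_single]; exact hb
  have nn : ∀ X : Set (Fin n), 0 ≤ (prodBernoulli w).real {ω : BondConfig (Fin n) | ∀ x ∈ X, ω ∉ openConn a₀ x} :=
    fun _ => measureReal_nonneg
  -- q ≤ u_i (the quadruple events contain the all-five event)
  have hq1 := avoid_real_anti w a₀ (show ({b₂, b₃, b₄, b₅} : Set (Fin n)) ⊆ ({b₁, b₂, b₃, b₄, b₅} : Set (Fin n)) from (by intro x hx; simp only [mem_insert_iff, mem_singleton_iff] at hx ⊢; tauto))
  have hq2 := avoid_real_anti w a₀ (show ({b₁, b₃, b₄, b₅} : Set (Fin n)) ⊆ ({b₁, b₂, b₃, b₄, b₅} : Set (Fin n)) from (by intro x hx; simp only [mem_insert_iff, mem_singleton_iff] at hx ⊢; tauto))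
  have hq3 := avoid_real_anti w a₀ (show ({b₁, b₂, b₄, b₅} : Set (Fin n)) ⊆ ({b₁, b₂, b₃, b₄, b₅} : Set (Fin n)) from (by intro x hx; simp only [mem_insert_iff, mem_singleton_iff] at hx ⊢; tauto))
  have hq4 := avoid_real_anti w a₀ (show ({b₁, b₂, b₃, b₅} : Set (Fin n)) ⊆ ({b₁, b₂, b₃, b₄, b₅} : Set (Fin n)) from (by intro x hx; simp only [mem_insert_iff, mem_singleton_iff] at hx ⊢; tauto))
  have hq5 := avoid_real_anti w a₀ (show ({b₁, b₂, b₃, b₄} : Set (Fin n)) ⊆ ({b₁, b₂, b₃, b₄, b₅} : Set (Fin n)) from (by intro x hx; simp only [mem_insert_iff, mem_singleton_iff] at hx ⊢; tauto))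
  -- u_i ≤ δ (a quadruple event is inside a single-vertex event)
  have hd1 := (avoid_real_anti w a₀ (show ({b₂} : Set (Fin n)) ⊆ ({b₂, b₃, b₄, b₅} : Set (Fin n)) from (by intro x hx; simp only [mem_insert_iff, mem_singleton_iff] at hx ⊢; tauto))).trans (hd b₂ h₂)
  have hd2 := (avoid_real_anti w a₀ (show ({b₁} : Set (Fin n)) ⊆ ({b₁, b₃, b₄, b₅} : Set (Fin n)) from (by intro x hx; simp only [mem_insert_iff, mem_singleton_iff] at hx ⊢; tauto))).trans (hd b₁ h₁)
  have hd3 := (avoid_real_anti w a₀ (show ({b₁} : Set (Fin n)) ⊆ ({b₁, b₂, b₄, b₅} : Set (Fin n)) from (by intro x hx; simp only [mem_insert_iff, mem_singleton_iff] at hx ⊢; tauto))).trans (hd b₁ h₁)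
  have hd4 := (avoid_real_anti w a₀ (show ({b₁} : Set (Fin n)) ⊆ ({b₁, b₂, b₃, b₅} : Set (Fin n)) from (by intro x hx; simp only [mem_insert_iff, mem_singleton_iff] at hx ⊢; tauto))).trans (hd b₁ h₁)
  have hd5 := (avoid_real_anti w a₀ (show ({b₁} : Set (Fin n)) ⊆ ({b₁, b₂, b₃, b₄} : Set (Fin n)) from (by intro x hx; simp only [mem_insert_iff, mem_singleton_iff] at hx ⊢; tauto))).trans (hd b₁ h₁)
  -- (A): pairs of quadruples (meet in a triple, join in all five)
  have A12 := avoid_real_bk w a₀ ({b₂, b₃, b₄, b₅} : Set (Fin n)) ({b₁, b₃, b₄, b₅} : Set (Fin n)) ({b₃, b₄, b₅} : Set (Fin n)) ({b₁, b₂, b₃, b₄, b₅} : Set (Fin n)) (by intro x hx; simp only [mem_insert_iff, mem_singleton_iff, mem_inter_iff] at hx ⊢; tauto) (by intro x hx; simp only [mem_insert_iff, mem_singleton_iff, mem_union] at hx ⊢; tauto)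
  have A13 := avoid_real_bk w a₀ ({b₂, b₃, b₄, b₅} : Set (Fin n)) ({b₁, b₂, b₄, b₅} : Set (Fin n)) ({b₂, b₄, b₅} : Set (Fin n)) ({b₁, b₂, b₃, b₄, b₅} : Set (Fin n)) (by intro x hx; simp only [mem_insert_iff, mem_singleton_iff, mem_inter_iff] at hx ⊢; tauto) (by intro x hx; simp only [mem_insert_iff, mem_singleton_iff, mem_union] at hx ⊢; tauto)
  have A14 := avoid_real_bk w a₀ ({b₂, b₃, b₄, b₅} : Set (Fin n)) ({b₁, b₂, b₃, b₅} : Set (Fin n)) ({b₂, b₃, b₅} : Set (Fin n)) ({b₁, b₂, b₃, b₄, b₅} : Set (Fin n)) (by intro x hx; simp only [mem_insert_iff, mem_singleton_iff, mem_inter_iff] at hx ⊢; tauto) (by intro x hx; simp only [mem_insert_iff, mem_singleton_iff, mem_union] at hx ⊢; tauto)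
  have A15 := avoid_real_bk w a₀ ({b₂, b₃, b₄, b₅} : Set (Fin n)) ({b₁, b₂, b₃, b₄} : Set (Fin n)) ({b₂, b₃, b₄} : Set (Fin n)) ({b₁, b₂, b₃, b₄, b₅} : Set (Fin n)) (by intro x hx; simp only [mem_insert_iff, mem_singleton_iff, mem_inter_iff] at hx ⊢; tauto) (by intro x hx; simp only [mem_insert_iff, mem_singleton_iff, mem_union] at hx ⊢; tauto)
  have A23 := avoid_real_bk w a₀ ({b₁, b₃, b₄, b₅} : Set (Fin n)) ({b₁, b₂, b₄, b₅} : Set (Fin n)) ({b₁, b₄, b₅} : Set (Fin n)) ({b₁, b₂, b₃, b₄, b₅} : Set (Fin n)) (by intro x hx; simp only [mem_insert_iff, mem_singleton_iff, mem_inter_iff] at hx ⊢; tauto) (by intro x hx; simp only [mem_insert_iff, mem_singleton_iff, mem_union] at hx ⊢; tauto)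
  have A24 := avoid_real_bk w a₀ ({b₁, b₃, b₄, b₅} : Set (Fin n)) ({b₁, b₂, b₃, b₅} : Set (Fin n)) ({b₁, b₃, b₅} : Set (Fin n)) ({b₁, b₂, b₃, b₄, b₅} : Set (Fin n)) (by intro x hx; simp only [mem_insert_iff, mem_singleton_iff, mem_inter_iff] at hx ⊢; tauto) (by intro x hx; simp only [mem_insert_iff, mem_singleton_iff, mem_union] at hx ⊢; tauto)
  have A25 := avoid_real_bk w a₀ ({b₁, b₃, b₄, b₅} : Set (Fin n)) ({b₁, b₂, b₃, b₄} : Set (Fin n)) ({b₁, b₃, b₄} : Set (Fin n)) ({b₁, b₂, b₃, b₄, b₅} : Set (Fin n)) (by intro x hx; simp only [mem_insert_iff, mem_singleton_iff, mem_inter_iff] at hx ⊢; tauto) (by intro x hx; simp only [mem_insert_iff, mem_singleton_iff, mem_union] at hx ⊢; tauto)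
  have A34 := avoid_real_bk w a₀ ({b₁, b₂, b₄, b₅} : Set (Fin n)) ({b₁, b₂, b₃, b₅} : Set (Fin n)) ({b₁, b₂, b₅} : Set (Fin n)) ({b₁, b₂, b₃, b₄, b₅} : Set (Fin n)) (by intro x hx; simp only [mem_insert_iff, mem_singleton_iff, mem_inter_iff] at hx ⊢; tauto) (by intro x hx; simp only [mem_insert_iff, mem_singleton_iff, mem_union] at hx ⊢; tauto)
  have A35 := avoid_real_bk w a₀ ({b₁, b₂, b₄, b₅} : Set (Fin n)) ({b₁, b₂, b₃, b₄} : Set (Fin n)) ({b₁, b₂, b₄} : Set (Fin n)) ({b₁, b₂, b₃, b₄, b₅} : Set (Fin n)) (by intro x hx; simp only [mem_insert_iff, mem_singleton_iff, mem_inter_iff] at hx ⊢; tauto) (by intro x hx; simp only [mem_insert_iff, mem_singleton_iff, mem_union] at hx ⊢; tauto)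
  have A45 := avoid_real_bk w a₀ ({b₁, b₂, b₃, b₅} : Set (Fin n)) ({b₁, b₂, b₃, b₄} : Set (Fin n)) ({b₁, b₂, b₃} : Set (Fin n)) ({b₁, b₂, b₃, b₄, b₅} : Set (Fin n)) (by intro x hx; simp only [mem_insert_iff, mem_singleton_iff, mem_inter_iff] at hx ⊢; tauto) (by intro x hx; simp only [mem_insert_iff, mem_singleton_iff, mem_union] at hx ⊢; tauto)
  -- (B): index-disjoint pairs of triples (meet in the fifth singleton, join in all five), then the single-vertex bound
  have B12_34 := (avoid_real_bk w a₀ ({b₃, b₄, b₅} : Set (Fin n)) ({b₁, b₂, b₅} : Set (Fin n)) ({b₅} : Set (Fin n)) ({b₁, b₂, b₃, b₄, b₅} : Set (Fin n)) (by intro x hx; simp only [mem_insert_iff, mem_singleton_iff, mem_inter_iff] at hx ⊢; tauto) (by intro x hx; simp only [mem_insert_iff, mem_singleton_iff, mem_union] at hx ⊢; tauto)).trans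
    (mul_le_mul_of_nonneg_right (hd b₅ h₅) (nn _))
  have B12_35 := (avoid_real_bk w a₀ ({b₃, b₄, b₅} : Set (Fin n)) ({b₁, b₂, b₄} : Set (Fin n)) ({b₄} : Set (Fin n)) ({b₁, b₂, b₃, b₄, b₅} : Set (Fin n)) (by intro x hx; simp only [mem_insert_iff, mem_singleton_iff, mem_inter_iff] at hx ⊢; tauto) (by intro x hx; simp only [mem_insert_iff, mem_singleton_iff, mem_union] at hx ⊢; tauto)).trans
    (mul_le_mul_of_nonneg_right (hd b₄ h₄) (nn _))
  have B12_45 := (avoid_real_bk w a₀ ({b₃, b₄, b₅} : Set (Fin n)) ({b₁, b₂, b₃} : Set (Fin n)) ({b₃} : Set (Fin n)) ({b₁, b₂, b₃, b₄, b₅} : Set (Fin n)) (by intro x hx; simp only [mem_insert_iff, mem_singleton_iff, mem_inter_iff] at hx ⊢; tauto) (by intro x hx; simp only [mem_insert_iff, mem_singleton_iff, mem_union] at hx ⊢; tauto)).trans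
    (mul_le_mul_of_nonneg_right (hd b₃ h₃) (nn _))
  have B13_45 := (avoid_real_bk w a₀ ({b₂, b₄, b₅} : Set (Fin n)) ({b₁, b₂, b₃} : Set (Fin n)) ({b₂} : Set (Fin n)) ({b₁, b₂, b₃, b₄, b₅} : Set (Fin n)) (by intro x hx; simp only [mem_insert_iff, mem_singleton_iff, mem_inter_iff] at hx ⊢; tauto) (by intro x hx; simp only [mem_insert_iff, mem_singleton_iff, mem_union] at hx ⊢; tauto)).trans
    (mul_le_mul_of_nonneg_right (hd b₂ h₂) (nn _))
  have B23_45 := (avoid_real_bk w a₀ ({b₁, b₄, b₅} : Set (Fin n)) ({b₁, b₂, b₃} : Set (Fin n)) ({b₁} : Set (Fin n)) ({b₁, b₂, b₃, b₄, b₅} : Set (Fin n)) (by intro x hx; simp only [mem_insert_iff, mem_singleton_iff, mem_inter_iff] at hx ⊢; tauto) (by intro x hx; simp only [mem_insert_iff, mem_singleton_iff, mem_union] at hx ⊢; tauto)).trans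
    (mul_le_mul_of_nonneg_right (hd b₁ h₁) (nn _))
  exact fourOfFive_sym δ (q := (prodBernoulli w).real {ω : BondConfig (Fin n) | ∀ x ∈ ({b₁, b₂, b₃, b₄, b₅} : Set (Fin n)), ω ∉ openConn a₀ x}) (u1 := (prodBernoulli w).real {ω : BondConfig (Fin n) | ∀ x ∈ ({b₂, b₃, b₄, b₅} : Set (Fin n)), ω ∉ openConn a₀ x}) (u2 := (prodBernoulli w).real {ω : BondConfig (Fin n) | ∀ x ∈ ({b₁, b₃, b₄, b₅} : Set (Fin n)), ω ∉ openConn a₀ x}) (u3 := (prodBernoulli w).real {ω : BondConfig (Fin n) | ∀ x ∈ ({b₁, b₂, b₄, b₅} : Set (Fin n)), ω ∉ openConn a₀ x}) (u4 := (prodBernoulli w).real {ω : BondConfig (Fin n) | ∀ x ∈ ({b₁, b₂, b₃, b₅} : Set (Fin n)), ω ∉ openConn a₀ x}) (u5 := (prodBernoulli w).real {ω : BondConfig (Fin n) | ∀ x ∈ ({b₁, b₂, b₃, b₄} : Set (Fin n)), ω ∉ openConn a₀ x}) (t12 := (prodBernoulli w).real {ω : BondConfig (Fin n) | ∀ x ∈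 ({b₃, b₄, b₅} : Set (Fin n)), ω ∉ openConn a₀ x}) (t13 := (prodBernoulli w).real {ω : BondConfig (Fin n) | ∀ x ∈ ({b₂, b₄, b₅} : Set (Fin n)), ω ∉ openConn a₀ x}) (t14 := (prodBernoulli w).real {ω : BondConfig (Fin n) | ∀ x ∈ ({b₂, b₃, b₅} : Set (Fin n)), ω ∉ openConn a₀ x}) (t15 := (prodBernoulli w).real {ω : BondConfig (Fin n) | ∀ x ∈ ({b₂, b₃, b₄} : Set (Fin n)), ω ∉ openConn a₀ x}) (t23 := (prodBernoulli w).real {ω : BondConfig (Fin n) | ∀ x ∈ ({b₁, b₄, b₅} : Set (Fin n)), ω ∉ openConn a₀ x}) (t24 := (prodBernoulli w).real {ω : BondConfig (Fin n) | ∀ x ∈ ({b₁, b₃, b₅} : Set (Fin n)), ω ∉ openConn a₀ x}) (t25 := (prodBernoulli w).real {ω : BondConfig (Fin n) | ∀ x ∈ ({b₁, b₃, b₄} : Set (Fin n)), ω ∉ openConn a₀ x}) (t34 := (prodBernoulli w).real {ω : BondConfig (Fin n) | ∀ x ∈ ({b₁, b₂, b₅} : Set (Fin n)), ω ∉ openConn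 a₀ x}) (t35 := (prodBernoulli w).real {ω : BondConfig (Fin n) | ∀ x ∈ ({b₁, b₂, b₄} : Set (Fin n)), ω ∉ openConn a₀ x}) (t45 := (prodBernoulli w).real {ω : BondConfig (Fin n) | ∀ x ∈ ({b₁, b₂, b₃} : Set (Fin n)), ω ∉ openConn a₀ x})
    (nn _) hq1 hq2 hq3 hq4 hq5 hd1 hd2 hd3 hd4 hd5
    A12 A13 A14 A15 A23 A24 A25 A34 A35 A45 B12_34 B12_35 B12_45 B13_45 B23_45

/-- **Four of five relays cut from the hub: `P ≤ (16875/16384)·max_i P(bᵢ ↮ a₀)`** — the union over the five quadruples `S ⊆ {b₁,…,b₅}`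
of `{a₀ ↛ S}`, bounded by splitting each along `{a₀ ↛ T}` and `fourOfFive_sum_le`. [cite: VandenbergKahn2001, Thm 1.2 (p. 123)] -/
theorem fourOfFive_cut (w : Sym2 (Fin n) → unitInterval) (a₀ b₁ b₂ b₃ b₄ b₅ : Fin n) (δ : ℝ)
    (h₁ : (prodBernoulli w).real (openConn a₀ b₁ : Set (BondConfig (Fin n)))ᶜ ≤ δ)
    (h₂ : (prodBernoulli w).real (openConn a₀ b₂ : Set (BondConfig (Fin n)))ᶜ ≤ δ)
    (h₃ : (prodBernoulli w).real (openConn a₀ b₃ : Set (BondConfig (Fin n)))ᶜ ≤ δ)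
    (h₄ : (prodBernoulli w).real (openConn a₀ b₄ : Set (BondConfig (Fin n)))ᶜ ≤ δ)
    (h₅ : (prodBernoulli w).real (openConn a₀ b₅ : Set (BondConfig (Fin n)))ᶜ ≤ δ) :
    (prodBernoulli w).real
        ({ω : BondConfig (Fin n) | ∀ x ∈ ({b₂, b₃, b₄, b₅} : Set (Fin n)), ω ∉ openConn a₀ x} ∪
          {ω : BondConfig (Fin n) | ∀ x ∈ ({b₁, b₃, b₄, b₅} : Set (Fin n)), ω ∉ openConn a₀ x} ∪
          {ω : BondConfig (Fin n) | ∀ x ∈ ({b₁, b₂, b₄, b₅} : Set (Fin n)), ω ∉ openConn a₀ x} ∪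
          {ω : BondConfig (Fin n) | ∀ x ∈ ({b₁, b₂, b₃, b₅} : Set (Fin n)), ω ∉ openConn a₀ x} ∪
          {ω : BondConfig (Fin n) | ∀ x ∈ ({b₁, b₂, b₃, b₄} : Set (Fin n)), ω ∉ openConn a₀ x}) ≤ 16875 / 16384 * δ := by
  have hsum := fourOfFive_sum_le w a₀ b₁ b₂ b₃ b₄ b₅ δ h₁ h₂ h₃ h₄ h₅
  -- the union bound through `{a₀ ↛ T}`
  have e1 := avoid_real_split w a₀ (show ({b₂, b₃, b₄, b₅} : Set (Fin n)) ⊆ ({b₁, b₂, b₃, b₄, b₅} : Set (Fin n)) from (by intro x hx; simp only [mem_insert_iff, mem_singleton_iff] at hx ⊢; tauto))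
  have e2 := avoid_real_split w a₀ (show ({b₁, b₃, b₄, b₅} : Set (Fin n)) ⊆ ({b₁, b₂, b₃, b₄, b₅} : Set (Fin n)) from (by intro x hx; simp only [mem_insert_iff, mem_singleton_iff] at hx ⊢; tauto))
  have e3 := avoid_real_split w a₀ (show ({b₁, b₂, b₄, b₅} : Set (Fin n)) ⊆ ({b₁, b₂, b₃, b₄, b₅} : Set (Fin n)) from (by intro x hx; simp only [mem_insert_iff, mem_singleton_iff] at hx ⊢; tauto))
  have e4 := avoid_real_split w a₀ (show ({b₁, b₂, b₃, b₅} : Set (Fin n)) ⊆ ({b₁, b₂, b₃, b₄, b₅} : Set (Fin n)) from (by intro x hx; simp only [mem_insert_iff, mem_singleton_iff] at hx ⊢; tauto))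
  have e5 := avoid_real_split w a₀ (show ({b₁, b₂, b₃, b₄} : Set (Fin n)) ⊆ ({b₁, b₂, b₃, b₄, b₅} : Set (Fin n)) from (by intro x hx; simp only [mem_insert_iff, mem_singleton_iff] at hx ⊢; tauto))
  have hcov : {ω : BondConfig (Fin n) | ∀ x ∈ ({b₂, b₃, b₄, b₅} : Set (Fin n)), ω ∉ openConn a₀ x} ∪
      {ω : BondConfig (Fin n) | ∀ x ∈ ({b₁, b₃, b₄, b₅} : Set (Fin n)), ω ∉ openConn a₀ x} ∪
      {ω : BondConfig (Fin n) | ∀ x ∈ ({b₁, b₂, b₄, b₅} : Set (Fin n)), ω ∉ openConn a₀ x} ∪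
      {ω : BondConfig (Fin n) | ∀ x ∈ ({b₁, b₂, b₃, b₅} : Set (Fin n)), ω ∉ openConn a₀ x} ∪
      {ω : BondConfig (Fin n) | ∀ x ∈ ({b₁, b₂, b₃, b₄} : Set (Fin n)), ω ∉ openConn a₀ x} ⊆
      {ω : BondConfig (Fin n) | ∀ x ∈ ({b₁, b₂, b₃, b₄, b₅} : Set (Fin n)), ω ∉ openConn a₀ x} ∪ ((((({ω : BondConfig (Fin n) | ∀ x ∈ ({b₂, b₃, b₄, b₅} : Set (Fin n)), ω ∉ openConn a₀ x} \ {ω : BondConfig (Fin n) | ∀ x ∈ ({b₁, b₂, b₃, b₄, b₅} : Set (Fin n)), ω ∉ openConn a₀ x}) ∪ ({ω : BondConfig (Fin n) | ∀ x ∈ ({b₁, b₃, b₄, b₅} : Set (Fin n)), ω ∉ openConn a₀ x} \ {ω : BondConfig (Fin n) | ∀ x ∈ ({b₁, b₂, b₃, b₄, b₅} : Set (Fin n)), ω ∉ openConn a₀ x})) ∪ ({ω : BondConfig (Fin n) | ∀ x ∈ ({b₁, b₂, b₄, b₅} : Set (Fin n)), ω ∉ openConn a₀ x} \ {ω : BondConfig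 (Fin n) | ∀ x ∈ ({b₁, b₂, b₃, b₄, b₅} : Set (Fin n)), ω ∉ openConn a₀ x})) ∪ ({ω : BondConfig (Fin n) | ∀ x ∈ ({b₁, b₂, b₃, b₅} : Set (Fin n)), ω ∉ openConn a₀ x} \ {ω : BondConfig (Fin n) | ∀ x ∈ ({b₁, b₂, b₃, b₄, b₅} : Set (Fin n)), ω ∉ openConn a₀ x})) ∪ ({ω : BondConfig (Fin n) | ∀ x ∈ ({b₁, b₂, b₃, b₄} : Set (Fin n)), ω ∉ openConn a₀ x} \ {ω : BondConfig (Fin n) | ∀ x ∈ ({b₁, b₂, b₃, b₄, b₅} : Set (Fin n)), ω ∉ openConn a₀ x})) := by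
    intro ω hω
    by_cases hb : ω ∈ {ω : BondConfig (Fin n) | ∀ x ∈ ({b₁, b₂, b₃, b₄, b₅} : Set (Fin n)), ω ∉ openConn a₀ x}
    · exact Or.inl hb
    · right
      rcases hω with (((h | h) | h) | h) | h
      · exact Or.inl (Or.inl (Or.inl (Or.inl ⟨h, hb⟩)))
      · exact Or.inl (Or.inl (Or.inl (Or.inr ⟨h, hb⟩)))
      · exact Or.inl (Or.inl (Or.inr ⟨h, hb⟩))
      · exact Or.inl (Or.inr ⟨h, hb⟩)
      · exact Or.inr ⟨h, hb⟩
  have u0 := measureReal_mono (μ := prodBernoulli w) hcov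
  have u1 := measureReal_union_le (μ := prodBernoulli w) {ω : BondConfig (Fin n) | ∀ x ∈ ({b₁, b₂, b₃, b₄, b₅} : Set (Fin n)), ω ∉ openConn a₀ x} ((((({ω : BondConfig (Fin n) | ∀ x ∈ ({b₂, b₃, b₄, b₅} : Set (Fin n)), ω ∉ openConn a₀ x} \ {ω : BondConfig (Fin n) | ∀ x ∈ ({b₁, b₂, b₃, b₄, b₅} : Set (Fin n)), ω ∉ openConn a₀ x}) ∪ ({ω : BondConfig (Fin n) | ∀ x ∈ ({b₁, b₃, b₄, b₅} : Set (Fin n)), ω ∉ openConn a₀ x} \ {ω : BondConfig (Fin n) | ∀ x ∈ ({b₁, b₂, b₃, b₄, b₅} : Set (Fin n)), ω ∉ openConn a₀ x})) ∪ ({ω : BondConfig (Fin n) | ∀ x ∈ ({b₁, b₂, b₄, b₅} : Set (Fin n)), ω ∉ openConn a₀ x} \ {ω : BondConfig (Fin n) | ∀ x ∈ ({b₁, b₂, b₃, b₄, b₅} : Set (Fin n)), ω ∉ openConn a₀ x})) ∪ ({ω : BondConfig (Fin n) | ∀ x ∈ ({b₁, b₂, b₃, b₅} : Set (Fin n)),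 ω ∉ openConn a₀ x} \ {ω : BondConfig (Fin n) | ∀ x ∈ ({b₁, b₂, b₃, b₄, b₅} : Set (Fin n)), ω ∉ openConn a₀ x})) ∪ ({ω : BondConfig (Fin n) | ∀ x ∈ ({b₁, b₂, b₃, b₄} : Set (Fin n)), ω ∉ openConn a₀ x} \ {ω : BondConfig (Fin n) | ∀ x ∈ ({b₁, b₂, b₃, b₄, b₅} : Set (Fin n)), ω ∉ openConn a₀ x}))
  have u2 := measureReal_union_le (μ := prodBernoulli w) (((({ω : BondConfig (Fin n) | ∀ x ∈ ({b₂, b₃, b₄, b₅} : Set (Fin n)), ω ∉ openConn a₀ x} \ {ω : BondConfig (Fin n) | ∀ x ∈ ({b₁, b₂, b₃, b₄, b₅} : Set (Fin n)), ω ∉ openConn a₀ x}) ∪ ({ω : BondConfig (Fin n) | ∀ x ∈ ({b₁, b₃, b₄, b₅} : Set (Fin n)), ω ∉ openConn a₀ x} \ {ω : BondConfig (Fin n) | ∀ x ∈ ({b₁, b₂, b₃, b₄, b₅} : Set (Fin n)), ω ∉ openConn a₀ x})) ∪ ({ω : BondConfig (Fin n) | ∀ x ∈ ({b₁, b₂,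 b₄, b₅} : Set (Fin n)), ω ∉ openConn a₀ x} \ {ω : BondConfig (Fin n) | ∀ x ∈ ({b₁, b₂, b₃, b₄, b₅} : Set (Fin n)), ω ∉ openConn a₀ x})) ∪ ({ω : BondConfig (Fin n) | ∀ x ∈ ({b₁, b₂, b₃, b₅} : Set (Fin n)), ω ∉ openConn a₀ x} \ {ω : BondConfig (Fin n) | ∀ x ∈ ({b₁, b₂, b₃, b₄, b₅} : Set (Fin n)), ω ∉ openConn a₀ x})) ({ω : BondConfig (Fin n) | ∀ x ∈ ({b₁, b₂, b₃, b₄} : Set (Fin n)), ω ∉ openConn a₀ x} \ {ω : BondConfig (Fin n) | ∀ x ∈ ({b₁, b₂, b₃, b₄, b₅} : Set (Fin n)), ω ∉ openConn a₀ x})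
  have u3 := measureReal_union_le (μ := prodBernoulli w) ((({ω : BondConfig (Fin n) | ∀ x ∈ ({b₂, b₃, b₄, b₅} : Set (Fin n)), ω ∉ openConn a₀ x} \ {ω : BondConfig (Fin n) | ∀ x ∈ ({b₁, b₂, b₃, b₄, b₅} : Set (Fin n)), ω ∉ openConn a₀ x}) ∪ ({ω : BondConfig (Fin n) | ∀ x ∈ ({b₁, b₃, b₄, b₅} : Set (Fin n)), ω ∉ openConn a₀ x} \ {ω : BondConfig (Fin n) | ∀ x ∈ ({b₁, b₂, b₃, b₄, b₅} : Set (Fin n)), ω ∉ openConn a₀ x})) ∪ ({ω : BondConfig (Fin n) | ∀ x ∈ ({b₁, b₂, b₄, b₅} : Set (Fin n)), ω ∉ openConn a₀ x} \ {ω : BondConfig (Fin n) | ∀ x ∈ ({b₁, b₂, b₃, b₄, b₅} : Set (Fin n)), ω ∉ openConn a₀ x})) ({ω : BondConfig (Fin n) | ∀ x ∈ ({b₁, b₂, b₃, b₅} : Set (Fin n)), ω ∉ openConn a₀ x} \ {ω : BondConfig (Fin n) | ∀ x ∈ ({b₁, b₂, b₃, b₄, b₅} : Set (Fin n)), ω ∉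 openConn a₀ x})
  have u4 := measureReal_union_le (μ := prodBernoulli w) (({ω : BondConfig (Fin n) | ∀ x ∈ ({b₂, b₃, b₄, b₅} : Set (Fin n)), ω ∉ openConn a₀ x} \ {ω : BondConfig (Fin n) | ∀ x ∈ ({b₁, b₂, b₃, b₄, b₅} : Set (Fin n)), ω ∉ openConn a₀ x}) ∪ ({ω : BondConfig (Fin n) | ∀ x ∈ ({b₁, b₃, b₄, b₅} : Set (Fin n)), ω ∉ openConn a₀ x} \ {ω : BondConfig (Fin n) | ∀ x ∈ ({b₁, b₂, b₃, b₄, b₅} : Set (Fin n)), ω ∉ openConn a₀ x})) ({ω : BondConfig (Fin n) | ∀ x ∈ ({b₁, b₂, b₄, b₅} : Set (Fin n)), ω ∉ openConn a₀ x} \ {ω : BondConfig (Fin n) | ∀ x ∈ ({b₁, b₂, b₃, b₄, b₅} : Set (Fin n)), ω ∉ openConn a₀ x})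
  have u5 := measureReal_union_le (μ := prodBernoulli w) ({ω : BondConfig (Fin n) | ∀ x ∈ ({b₂, b₃, b₄, b₅} : Set (Fin n)), ω ∉ openConn a₀ x} \ {ω : BondConfig (Fin n) | ∀ x ∈ ({b₁, b₂, b₃, b₄, b₅} : Set (Fin n)), ω ∉ openConn a₀ x}) ({ω : BondConfig (Fin n) | ∀ x ∈ ({b₁, b₃, b₄, b₅} : Set (Fin n)), ω ∉ openConn a₀ x} \ {ω : BondConfig (Fin n) | ∀ x ∈ ({b₁, b₂, b₃, b₄, b₅} : Set (Fin n)), ω ∉ openConn a₀ x})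
  linarith only [hsum, u0, u1, u2, u3, u4, u5, e1, e2, e3, e4, e5]

/-! ### `|A| = 7`: loss `(33259/16384)·max` -/

/-- **At least four of five relays cut: `μ ≤ (16875/16384)·δ`**, counting form over a 5-element finset (hub-second orientation `v ↮ a₀`).
[cite: VandenbergKahn2001, Thm 1.2 (p. 123)] -/
theorem fourOfFive_count (w : Sym2 (Fin n) → unitInterval) (a₀ : Fin n) (T : Finset (Fin n)) (hT : T.card = 5) (δ : ℝ)
    (hδ : ∀ v ∈ T, (prodBernoulli w).real (openConn v a₀ : Set (BondConfig (Fin n)))ᶜ ≤ δ) :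
    (prodBernoulli w).real {ω : BondConfig (Fin n) | 4 ≤ (T.filter fun v => ω ∉ openConn v a₀).card} ≤ 16875 / 16384 * δ := by
  obtain ⟨b₁, T', hb₁T', hTins, hT'⟩ := Finset.card_eq_succ.1 hT
  obtain ⟨b₂, T'', hb₂T'', hT'ins, hT''⟩ := Finset.card_eq_succ.1 hT'
  obtain ⟨b₃, b₄, b₅, h34, h35, h45, hT''eq⟩ := Finset.card_eq_three.1 hT''
  have hmem : ∀ v, v ∈ T ↔ v = b₁ ∨ v = b₂ ∨ v = b₃ ∨ v = b₄ ∨ v = b₅ := by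
    intro v; rw [← hTins, ← hT'ins, hT''eq]; simp
  have h23 : b₂ ≠ b₃ := by rintro rfl; exact hb₂T'' (by rw [hT''eq]; simp)
  have h24 : b₂ ≠ b₄ := by rintro rfl; exact hb₂T'' (by rw [hT''eq]; simp)
  have h25 : b₂ ≠ b₅ := by rintro rfl; exact hb₂T'' (by rw [hT''eq]; simp)
  have h12 : b₁ ≠ b₂ := by rintro rfl; exact hb₁T' (by rw [← hT'ins]; simp)
  have h13 : b₁ ≠ b₃ := by rintro rfl; exact hb₁T' (by rw [← hT'ins, hT''eq]; simp)
  have h14 : b₁ ≠ b₄ := by rintro rfl; exact hb₁T' (by rw [← hT'ins, hT''eq]; simp)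
  have h15 : b₁ ≠ b₅ := by rintro rfl; exact hb₁T' (by rw [← hT'ins, hT''eq]; simp)
  have hd : ∀ b, b ∈ T → (prodBernoulli w).real (openConn a₀ b : Set (BondConfig (Fin n)))ᶜ ≤ δ := by
    intro b hb; rw [knThm2_openConn_comm]; exact hδ b hb
  have hb1 : b₁ ∈ T := (hmem b₁).2 (Or.inl rfl)
  have hb2 : b₂ ∈ T := (hmem b₂).2 (Or.inr (Or.inl rfl))
  have hb3 : b₃ ∈ T := (hmem b₃).2 (Or.inr (Or.inr (Or.inl rfl)))
  have hb4 : b₄ ∈ T := (hmem b₄).2 (Or.inr (Or.inr (Or.inr (Or.inl rfl))))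
  have hb5 : b₅ ∈ T := (hmem b₅).2 (Or.inr (Or.inr (Or.inr (Or.inr rfl))))
  refine le_trans (measureReal_mono ?_) (fourOfFive_cut w a₀ b₁ b₂ b₃ b₄ b₅ δ (hd _ hb1) (hd _ hb2) (hd _ hb3) (hd _ hb4) (hd _ hb5))
  intro ω hω
  simp only [mem_setOf_eq] at hω
  -- two distinct un-cut relays contradict the count
  have key : ∀ u v, u ∈ T → v ∈ T → u ≠ v → ω ∈ openConn u a₀ → ω ∉ openConn v a₀ := by
    intro u v hu hv huv hcu hcv
    have hsplit := Finset.card_filter_add_card_filter_not (s := T) (fun x => ω ∉ openConn x a₀)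
    have h2 : 2 ≤ (T.filter fun x => ¬ ω ∉ openConn x a₀).card := by
      have hsub : ({u, v} : Finset (Fin n)) ⊆ T.filter fun x => ¬ ω ∉ openConn x a₀ := by
        intro y hy
        rcases Finset.mem_insert.1 hy with rfl | hy
        · exact Finset.mem_filter.2 ⟨hu, not_not.2 hcu⟩
        · rw [Finset.mem_singleton.1 hy]; exact Finset.mem_filter.2 ⟨hv, not_not.2 hcv⟩
      have := Finset.card_le_card hsub
      rwa [Finset.card_pair huv] at this
    omega
  -- orientation
  have cut : ∀ v, ω ∉ openConn v a₀ → ω ∉ (openConn a₀ v : Set (BondConfig (Fin n))) := by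
    intro v hv; rwa [knThm2_openConn_comm]
  by_cases c1 : ω ∈ openConn b₁ a₀
  · -- b₁ joined: b₂, b₃, b₄, b₅ cut
    left; left; left; left
    intro x hx
    simp only [mem_insert_iff, mem_singleton_iff] at hx
    rcases hx with rfl | rfl | rfl | rfl
    · exact cut _ (key b₁ _ hb1 hb2 h12 c1)
    · exact cut _ (key b₁ _ hb1 hb3 h13 c1)
    · exact cut _ (key b₁ _ hb1 hb4 h14 c1)
    · exact cut _ (key b₁ _ hb1 hb5 h15 c1)
  by_cases c2 : ω ∈ openConn b₂ a₀
  · left; left; left; right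
    intro x hx
    simp only [mem_insert_iff, mem_singleton_iff] at hx
    rcases hx with rfl | rfl | rfl | rfl
    · exact cut _ c1
    · exact cut _ (key b₂ _ hb2 hb3 h23 c2)
    · exact cut _ (key b₂ _ hb2 hb4 h24 c2)
    · exact cut _ (key b₂ _ hb2 hb5 h25 c2)
  by_cases c3 : ω ∈ openConn b₃ a₀
  · left; left; right
    intro x hx
    simp only [mem_insert_iff, mem_singleton_iff] at hx
    rcases hx with rfl | rfl | rfl | rfl
    · exact cut _ c1
    · exact cut _ c2
    · exact cut _ (key b₃ _ hb3 hb4 h34 c3)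
    · exact cut _ (key b₃ _ hb3 hb5 h35 c3)
  by_cases c4 : ω ∈ openConn b₄ a₀
  · left; right
    intro x hx
    simp only [mem_insert_iff, mem_singleton_iff] at hx
    rcases hx with rfl | rfl | rfl | rfl
    · exact cut _ c1
    · exact cut _ c2
    · exact cut _ c3
    · exact cut _ (key b₄ _ hb4 hb5 h45 c4)
  · right
    intro x hx
    simp only [mem_insert_iff, mem_singleton_iff] at hx
    rcases hx with rfl | rfl | rfl | rfl
    · exact cut _ c1
    · exact cut _ c2
    · exact cut _ c3
    · exact cut _ c4

/-- **MAJORITY GLUING AT `|A| = 7` WITH LOSS `(33259/16384)·max` (`≈ 2.0300·max`; the tree had `9/4`), unconditionally** — from van den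
Berg–Kahn log-supermodularity through the hub-only reduction: for every weight function, observer `o`, hub `a₀ ∈ A`, `|A| = 7` and
`δ₀ ≥ max_{a∈A} μ(a ↮ a₀)`:  `μ(o ↔ a₀ ∧ 2N > 7) ≥ μ(o ↔ A) − (33259/16384)·δ₀`.  Proof: for each `a ∈ A` there is `c ∈ A ∖ {a₀}` with
`H_a ⊆ {c ↮ a₀} ∪ {≥ 4 of the five relays A ∖ {a₀, c} cut}`, so `μ(H_a) ≤ max + (16875/16384)·max` (`fourOfFive_count`), and
`HubOnly.majorityGluing_of_hubOnly` closes over all weights. [cite: VandenbergKahn2001, Thm 1.2 (p. 123)] [cite: KozmaNitzan2024, Conj. 1 (p. 3)] -/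
theorem majorityGluing_vdBK_card_seven (w : Sym2 (Fin n) → unitInterval) (A : Finset (Fin n)) (o a₀ : Fin n) (δ₀ : ℝ)
    (ha₀ : a₀ ∈ A) (hA : A.card = 7) (hδ₀ : ∀ a ∈ A, (prodBernoulli w).real (openConn a a₀ : Set (BondConfig (Fin n)))ᶜ ≤ δ₀) :
    (prodBernoulli w).real (⋃ a ∈ A, openConn o a) - 33259 / 16384 * δ₀ ≤
      (prodBernoulli w).real {ω : BondConfig (Fin n) | ω ∈ openConn o a₀ ∧
          A.card < 2 * (A.filter fun a => ω ∈ openConn o a).card} := by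
  have h := majorityGluing_of_hubOnly (n := n) (33259 / 16384) (by norm_num) A a₀ ha₀ ?_ w o δ₀ hδ₀
  · linarith
  intro p hp a ha
  set μ := prodBernoulli p with hμ
  set δ : Fin n → ℝ := fun x => μ.real (openConn x a₀ : Set (BondConfig (Fin n)))ᶜ with hδ
  set M := A.sup' ⟨a₀, ha₀⟩ δ with hM
  have hδle : ∀ x ∈ A, δ x ≤ M := fun x hx => Finset.le_sup' δ hx
  -- the auxiliary relay `c ≠ a₀`
  obtain ⟨c, hcA, hca₀, hca⟩ : ∃ c ∈ A, c ≠ a₀ ∧ (a ≠ a₀ → c = a) := by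
    by_cases haa : a = a₀
    · have hpos : 1 < A.card := by rw [hA]; norm_num
      obtain ⟨c, hc, hne⟩ := Finset.exists_mem_ne hpos a₀
      exact ⟨c, hc, hne, fun h => (h haa).elim⟩
    · exact ⟨a, ha, haa, fun _ => rfl⟩
  set T : Finset (Fin n) := (A.erase a₀).erase c with hT
  have hcT : c ∈ A.erase a₀ := Finset.mem_erase.2 ⟨hca₀, hcA⟩
  have hTcard : T.card = 5 := by
    rw [hT, Finset.card_erase_of_mem hcT, Finset.card_erase_of_mem ha₀, hA]
  have hTA : T ⊆ A := (Finset.erase_subset _ _).trans (Finset.erase_subset _ _)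
  -- `H_a ⊆ {c ↮ a₀} ∪ {≥ 4 of T cut}`
  have hsub : {ω : BondConfig (Fin n) | ω ∈ openConn a a₀ → 2 * (A.filter fun a' => ω ∈ openConn a' a₀).card ≤ A.card} ⊆
      (openConn c a₀ : Set (BondConfig (Fin n)))ᶜ ∪ {ω | 4 ≤ (T.filter fun v => ω ∉ openConn v a₀).card} := by
    intro ω hω
    by_cases hcc : ω ∈ openConn c a₀
    · right
      -- `a ↔ a₀`: either `a = c` (joined) or `a = a₀`
      have haa : ω ∈ openConn a a₀ := by
        by_cases h' : a = a₀
        · rw [h']; exact (SimpleGraph.Reachable.refl _ : (openGraph ω).Reachable a₀ a₀)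
        · rw [← hca h']; exact hcc
      have hle := hω haa
      rw [hA] at hle
      have hsplit := Finset.card_filter_add_card_filter_not (s := A) (fun a' => ω ∈ openConn a' a₀)
      rw [hA] at hsplit
      have hcut : (A.filter fun a' => ¬ ω ∈ openConn a' a₀) ⊆ T.filter fun v => ω ∉ openConn v a₀ := by
        intro x hx
        rw [Finset.mem_filter] at hx ⊢
        refine ⟨?_, hx.2⟩
        rw [hT, Finset.mem_erase, Finset.mem_erase]
        refine ⟨?_, ?_, hx.1⟩
        · rintro rfl; exact hx.2 hcc
        · rintro rfl; exact hx.2 (SimpleGraph.Reachable.refl _ : (openGraph ω).Reachable x x)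
      have hc := Finset.card_le_card hcut
      simp only [mem_setOf_eq]
      omega
    · left; exact hcc
  have h45 := fourOfFive_count p a₀ T hTcard M (fun v hv => hδle v (hTA hv))
  calc μ.real {ω : BondConfig (Fin n) | ω ∈ openConn a a₀ → 2 * (A.filter fun a' => ω ∈ openConn a' a₀).card ≤ A.card}
      ≤ μ.real ((openConn c a₀ : Set (BondConfig (Fin n)))ᶜ ∪ {ω | 4 ≤ (T.filter fun v => ω ∉ openConn v a₀).card}) :=
        measureReal_mono hsub
    _ ≤ μ.real (openConn c a₀ : Set (BondConfig (Fin n)))ᶜ + μ.real {ω : BondConfig (Fin n) | 4 ≤ (T.filter fun v => ω ∉ openConn v a₀).card} :=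
        measureReal_union_le _ _
    _ ≤ M + 16875 / 16384 * M := add_le_add (hδle c hcA) h45
    _ = 33259 / 16384 * M := by ring

end HubOnly

end Summit.CriticalPhenomena.PercolationContinuityZ3.Theorems

end
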